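import Mathlib.MeasureTheory.Measure.Lebesgue.Complex
import Mathlib.Topology.MetricSpace.Thickening
import Mathlib.Topology.MetricSpace.IsometricSMul
import Mathlib.MeasureTheory.Group.Measure
import Mathlib.MeasureTheory.Measure.Lebesgue.EqHaar
import Mathlib.Analysis.Normed.Module.Ball.Pointwise
import Mathlib.Analysis.SpecialFunctions.Pow.Real
import Mathlib.LinearAlgebra.Complex.FiniteDimensional
import Literature.Probability.RandomPlanarGeometry.CurveSpace
import Literature.Probability.RandomPlanarGeometry.FusionMap
import HarnessLib

/-!
# Minkowski content, the natural parametrisation, and operations on two-sided paths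

Topic `Probability/RandomPlanarGeometry`. Support file for the definition request
`defn-TwoSidedWholePlaneSLE` (route `SAWDimerizationRG`; sequel `TwoSidedWholePlaneSLE`): the
parametrisation-level vocabulary in which "two-sided whole-plane SLE_{8/3} through `0` with its
natural parametrisation", "re-rooting by natural length" and "unit natural-length window" are
stated. Everything here is proved; no named fact is introduced.

* **Minkowski content** (`minkowskiContentAt`, `HasMinkowskiContent`):
  `Cont_d(S) = lim_{ε ↓ 0} ε^{d-2} Area{z : dist(z, S) ≤ ε}` (Lawler–Rezaei (2015), §2.2, written
  with `ε = e^{-r}`; Zhan (2021), §2.3), as a `Tendsto` statement (no junk limit).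
* **Natural parametrisation** `IsNaturallyParametrized d γ` of a two-sided path `γ : ℝ → ℂ`:
  `Cont_d(γ[a, b]) = b - a` for all `a ≤ b` (Zhan (2021), Def. 2.1, Def. 2.3, Rem. 2.4: "`γ` is
  parametrized by its Minkowski content measure"; Lawler–Rezaei (2015), Thm 1.1: for SLE_κ the
  natural parametrisation is `d = 1 + κ/8`-dimensional Minkowski content). PROVED: invariance under
  translation of the path, time shift, re-rooting (`IsNaturallyParametrized.reroot`, with
  `RootedCurve.reroot` of `FusionMap`), reversal, and dilations `t ↦ a^ν γ(t/a)` with `ν d = 1`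
  (`IsNaturallyParametrized.dilatePath`, from the scaling covariance `Cont_d(rS) = r^d Cont_d(S)`,
  `HasMinkowskiContent.smul`) — via the invariance/covariance of closed neighbourhoods and of
  Lebesgue measure on `ℂ`.
* **Operations on `C(ℝ, ℂ)`** (two-sided parametrised paths, topology of locally uniform
  convergence, scoped Borel structure `PathBorel.instMeasurableSpaceTwoSidedPath`): dilations
  `dilatePath ν a γ = a^ν · γ(· / a)` (the convention of `RootedCurve.dilate`: time `× a`, space
  `× a^ν`), rotations `rotatePath θ`, reversal `reversePath`; the window
  `rootedWindow T γ : RootedCurve ℂ` (`t ↦ γ t - γ 0` on `[0, T]`, a naturally parametrised rooted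
  curve of `FusionMap`; `T = 1` is the unit natural-length window) and its unparametrised class
  `windowClass T γ : CurveClass ℂ`. All are proved continuous, hence Borel measurable.
* **Law-level predicates** on `Measure C(ℝ, ℂ)`: `IsRerootInvariant` (stationarity under re-rooting
  by natural length), `IsSelfSimilar ν` (exact scale invariance), `IsRotationInvariant` — the
  hypothesis slots of the route's crux `FusionRigidity`.

## References

* G. F. Lawler, M. A. Rezaei, *Minkowski content and natural parameterization for the
  Schramm–Loewner evolution*, Ann. Probab. 43 (2015), Thm 1.1, §2.2. [LawlerRezaei2015]
* D. Zhan, *SLE loop measures*, PTRF 179 (2021), arXiv:1702.08026: §2.3 (Def. 2.1, Def. 2.3,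
  Rem. 2.4), Cor. 4.7 (self-similarity, stationary increments). [Zhan2021SLELoopMeasures]
* G. F. Lawler, S. Sheffield, *A natural parametrization for the Schramm–Loewner evolution*,
  Ann. Probab. 39 (2011), §1.2. [LawlerSheffield2011]
-/

noncomputable section

open Set Filter Topology MeasureTheory Complex
open Literature.Probability.RandomPlanarGeometry.RootedCurve (reroot reroot_apply reroot_reroot
  continuous_reroot)
open scoped NNReal Real ENNReal

namespace Literature.Probability.RandomPlanarGeometry

/-! ### Borel structure on the two-sided path space (scoped, cf. `WholePlaneSLE`, `SLETraceApproximation`) -/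

namespace PathBorel

/-- Borel σ-algebra on the two-sided planar path space `C(ℝ, ℂ)` (compact-open topology). [folklore] -/
scoped instance instMeasurableSpaceTwoSidedPath : MeasurableSpace C(ℝ, ℂ) := borel _

/-- `C(ℝ, ℂ)` with its Borel σ-algebra is a Borel space. [folklore] -/
scoped instance instBorelSpaceTwoSidedPath : BorelSpace C(ℝ, ℂ) := ⟨rfl⟩

end PathBorel

open scoped PathBorel

/-! ### Minkowski content and the natural parametrisation -/

/-- The **`d`-dimensional Minkowski content functional at scale `ε`** of `S ⊆ ℂ`:
`ε^{d-2} · Area{z : dist(z, S) ≤ ε}` (closed `ε`-neighbourhood, two-dimensional Lebesgue measure).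
Lawler–Rezaei (2015), §2.2 (`Cont_d(V; r) = e^{r(2-d)} Area{z : dist(z, V) ≤ e^{-r}}`, here with
`ε = e^{-r}`); Zhan (2021), §2.3. [cite: LawlerRezaei2015, §2.2] -/
def minkowskiContentAt (d ε : ℝ) (S : Set ℂ) : ℝ≥0∞ :=
  ENNReal.ofReal (ε ^ (d - 2)) * volume (Metric.cthickening ε S)

/-- `S ⊆ ℂ` **has `d`-dimensional Minkowski content `m`**: `ε^{d-2} Area{dist(·, S) ≤ ε} → m` as
`ε ↓ 0` (the limit in Lawler–Rezaei (2015), (2) / §2.2 "`Cont_d(V) = lim_{r → ∞} Cont_d(V; r)`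
provided the limit exists"; Zhan (2021), §2.3). Stated with `Tendsto`, so no junk value is involved
when the limit does not exist. [cite: LawlerRezaei2015, §2.2] -/
def HasMinkowskiContent (d : ℝ) (S : Set ℂ) (m : ℝ≥0∞) : Prop :=
  Tendsto (fun ε ↦ minkowskiContentAt d ε S) (𝓝[>] 0) (𝓝 m)

/-- Sanity / non-vacuity: for `d = 2` the Minkowski content of a compact set is its area
(`ε⁰ · Area(N̄_ε K) → Area(K)` by continuity of measure along shrinking closed neighbourhoods).
Lawler–Rezaei (2015), §1 ("If `κ ≥ 8`, then `d = 2`, and the `2`-dimensional Minkowski content is the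
same as the area"). [cite: LawlerRezaei2015, §1] -/
theorem IsCompact.hasMinkowskiContent_two {K : Set ℂ} (hK : IsCompact K) :
    HasMinkowskiContent 2 K (volume K) := by
  unfold HasMinkowskiContent minkowskiContentAt
  have h := (tendsto_measure_cthickening_of_isCompact (μ := volume) hK).mono_left
    (nhdsWithin_le_nhds (s := Ioi (0 : ℝ)))
  refine h.congr' ?_
  filter_upwards [self_mem_nhdsWithin] with ε _
  rw [sub_self, Real.rpow_zero, ENNReal.ofReal_one, one_mul]

/-- The two-sided path `γ : ℝ → ℂ` is **parametrised by `d`-dimensional Minkowski content**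
("natural parametrisation"): every arc `γ[a, b]` has `d`-dimensional Minkowski content `b - a`.
Zhan (2021), Def. 2.1, Def. 2.3 and Rem. 2.4 ("we may reparametrize `γ` such that for any `a ≤ b` in
the definition domain, `μ(γ([a, b])) = b - a` … we say that `γ` is parametrized by `μ`", with `μ` the
Minkowski content measure, `μ(γ[a, b]) = Cont(γ[a, b])`); Lawler–Rezaei (2015), Thm 1.1 (for SLE_κ
the natural parametrisation is `d = 1 + κ/8`-dimensional Minkowski content: `Cont_d(γ̃[0, t]) = t`).
[cite: Zhan2021SLELoopMeasures, Def. 2.3 / Rem. 2.4] -/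
def IsNaturallyParametrized (d : ℝ) (γ : ℝ → ℂ) : Prop :=
  ∀ a b : ℝ, a ≤ b → HasMinkowskiContent d (γ '' Icc a b) (ENNReal.ofReal (b - a))

/-- A naturally parametrised path gives content `0` to points: `Cont_d(γ[a, a]) = 0`. [folklore] -/
theorem IsNaturallyParametrized.hasMinkowskiContent_singleton {d : ℝ} {γ : ℝ → ℂ}
    (h : IsNaturallyParametrized d γ) (a : ℝ) : HasMinkowskiContent d {γ a} 0 := by
  simpa using h a a le_rfl

/-- Reversal preserves the natural parametrisation: `t ↦ γ(-t)` maps `[a, b]` onto `γ[-b, -a]`,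
of content `(-a) - (-b) = b - a`. [folklore] -/
theorem IsNaturallyParametrized.comp_neg {d : ℝ} {γ : ℝ → ℂ} (h : IsNaturallyParametrized d γ) :
    IsNaturallyParametrized d (fun t ↦ γ (-t)) := by
  intro a b hab
  have himage : (fun t ↦ γ (-t)) '' Icc a b = γ '' Icc (-b) (-a) := by
    rw [show (fun t ↦ γ (-t)) = γ ∘ Neg.neg from rfl, image_comp, image_neg_Icc]
  rw [himage, show b - a = -a - -b by ring]
  exact h (-b) (-a) (neg_le_neg hab)

/-! ### Operations on two-sided parametrised paths -/

section PathOps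

/-! Re-rooting by natural length `s` is `reroot s γ = γ(s + ·) - γ(s)` of `FusionMap` (defined there
for the fusion map of the same route); we add its measurability and the remaining operations. -/

/-- Re-rooting (`FusionMap.reroot`) is Borel measurable on `C(ℝ, ℂ)`. [folklore] -/
theorem measurable_reroot (s : ℝ) : Measurable (reroot s : C(ℝ, ℂ) → C(ℝ, ℂ)) :=
  (continuous_reroot s).measurable

/-- Re-rooting by `0` is the identity on paths rooted at the origin. [folklore] -/
theorem reroot_zero_of_apply_zero {γ : C(ℝ, ℂ)} (h : γ 0 = 0) : reroot 0 γ = γ := by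
  ext t; simp [reroot_apply, h]

/-- Closed `ε`-neighbourhoods commute with isometric equivalences of the plane. [folklore] -/
theorem image_cthickening_isometryEquiv (Φ : ℂ ≃ᵢ ℂ) (ε : ℝ) (S : Set ℂ) :
    Φ '' Metric.cthickening ε S = Metric.cthickening ε (Φ '' S) := by
  ext z
  constructor
  · rintro ⟨x, hx, rfl⟩
    rw [Metric.mem_cthickening_iff, Metric.infEDist_image Φ.isometry]
    exact hx
  · intro hz
    refine ⟨Φ.symm z, ?_, Φ.apply_symm_apply z⟩
    rw [Metric.mem_cthickening_iff] at hz ⊢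
    rwa [← Metric.infEDist_image Φ.isometry, Φ.apply_symm_apply]

/-- The Minkowski content functional is invariant under translations (Lebesgue measure and closed
neighbourhoods are). [folklore] -/
theorem minkowskiContentAt_image_add_const (d ε : ℝ) (S : Set ℂ) (v : ℂ) :
    minkowskiContentAt d ε ((· + v) '' S) = minkowskiContentAt d ε S := by
  unfold minkowskiContentAt
  rw [show (· + v) '' S = (IsometryEquiv.addRight v) '' S from rfl,
    ← image_cthickening_isometryEquiv]
  simp

/-- Minkowski content is invariant under translations. [folklore] -/
theorem HasMinkowskiContent.image_add_const {d : ℝ} {S : Set ℂ} {m : ℝ≥0∞}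
    (h : HasMinkowskiContent d S m) (v : ℂ) : HasMinkowskiContent d ((· + v) '' S) m := by
  unfold HasMinkowskiContent at h ⊢
  simpa only [minkowskiContentAt_image_add_const] using h

/-- Translating a path preserves the natural parametrisation. [folklore] -/
theorem IsNaturallyParametrized.add_const {d : ℝ} {γ : ℝ → ℂ} (h : IsNaturallyParametrized d γ)
    (v : ℂ) : IsNaturallyParametrized d (fun t ↦ γ t + v) := by
  intro a b hab
  rw [show (fun t ↦ γ t + v) = (· + v) ∘ γ from rfl, image_comp]
  exact (h a b hab).image_add_const v

/-- Shifting time preserves the natural parametrisation: `γ(s + ·)` maps `[a, b]` onto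
`γ[s + a, s + b]`, of content `b - a`. [folklore] -/
theorem IsNaturallyParametrized.comp_const_add {d : ℝ} {γ : ℝ → ℂ}
    (h : IsNaturallyParametrized d γ) (s : ℝ) : IsNaturallyParametrized d (fun t ↦ γ (s + t)) := by
  intro a b hab
  rw [show (fun t ↦ γ (s + t)) = γ ∘ (fun t ↦ s + t) from rfl, image_comp, image_const_add_Icc,
    show b - a = (s + b) - (s + a) by ring]
  exact h (s + a) (s + b) (by linarith)

/-- **Re-rooting preserves the natural parametrisation**: if `γ` is parametrised by
`d`-dimensional Minkowski content, so is `reroot s γ = γ(s + ·) - γ(s)` (translation invariance of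
Lebesgue measure) — the parametrised counterpart of the map `𝒯_γ` in the proof of Zhan (2021),
Cor. 4.7. [cite: Zhan2021SLELoopMeasures, Cor. 4.7] -/
theorem IsNaturallyParametrized.reroot {d : ℝ} {γ : C(ℝ, ℂ)} (h : IsNaturallyParametrized d γ)
    (s : ℝ) : IsNaturallyParametrized d (RootedCurve.reroot s γ) := by
  have : ⇑(RootedCurve.reroot s γ) = fun t ↦ γ (s + t) + (-γ s) := by
    ext t; simp [sub_eq_add_neg]
  rw [this]
  exact (h.comp_const_add s).add_const (-γ s)

/-- **Dilation with exponent `ν`** of a two-sided path: time multiplied by `a`, space by `a ^ ν`,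
`dilatePath ν a γ = a^ν · γ(· / a)` (`a > 0`; the convention of `RootedCurve.dilate`). A path
parametrised by `d`-dimensional Minkowski content stays so parametrised when `ν = 1/d`, and
"`γ̂` is self-similar of index `1/d`" (Zhan (2021), Cor. 4.7: `(γ̂(a t))ₜ` and `(a^{1/d} γ̂(t))ₜ`
have the same law) is invariance of the law under every `dilatePath (1/d) a`, `a > 0`.
[cite: Zhan2021SLELoopMeasures, Cor. 4.7] -/
def dilatePath (ν a : ℝ) (γ : C(ℝ, ℂ)) : C(ℝ, ℂ) where
  toFun t := ((a ^ ν : ℝ) : ℂ) * γ (t / a)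
  continuous_toFun := continuous_const.mul (γ.continuous.comp (continuous_id.div_const _))

/-- Value of a dilated path. [folklore] -/
@[simp] theorem dilatePath_apply (ν a : ℝ) (γ : C(ℝ, ℂ)) (t : ℝ) :
    dilatePath ν a γ t = ((a ^ ν : ℝ) : ℂ) * γ (t / a) := rfl

/-- Dilation by `a = 1` is the identity. [folklore] -/
@[simp] theorem dilatePath_one (ν : ℝ) (γ : C(ℝ, ℂ)) : dilatePath ν 1 γ = γ := by
  ext t; simp

/-- Dilation is continuous on `C(ℝ, ℂ)`. [folklore] -/
theorem continuous_dilatePath (ν a : ℝ) : Continuous (dilatePath ν a) := by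
  refine ContinuousMap.continuous_of_continuous_uncurry _ ?_
  change Continuous fun p : C(ℝ, ℂ) × ℝ ↦ ((a ^ ν : ℝ) : ℂ) * p.1 (p.2 / a)
  fun_prop

/-- Dilation is Borel measurable. [folklore] -/
theorem measurable_dilatePath (ν a : ℝ) : Measurable (dilatePath ν a) :=
  (continuous_dilatePath ν a).measurable

/-- **Rotation** of a path by the angle `θ`: `rotatePath θ γ = e^{iθ} γ`. [folklore] -/
def rotatePath (θ : ℝ) (γ : C(ℝ, ℂ)) : C(ℝ, ℂ) where
  toFun t := exp (θ * I) * γ t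
  continuous_toFun := continuous_const.mul γ.continuous

/-- Value of a rotated path. [folklore] -/
@[simp] theorem rotatePath_apply (θ : ℝ) (γ : C(ℝ, ℂ)) (t : ℝ) :
    rotatePath θ γ t = exp (θ * I) * γ t := rfl

/-- Rotation by `0` is the identity. [folklore] -/
@[simp] theorem rotatePath_zero (γ : C(ℝ, ℂ)) : rotatePath 0 γ = γ := by
  ext t; simp

/-- Rotations compose additively. [folklore] -/
theorem rotatePath_add (θ θ' : ℝ) (γ : C(ℝ, ℂ)) :
    rotatePath (θ + θ') γ = rotatePath θ (rotatePath θ' γ) := by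
  ext t
  simp only [rotatePath_apply]
  rw [show ((θ + θ' : ℝ) : ℂ) * I = θ * I + θ' * I by push_cast; ring, exp_add]
  ring

/-- Rotation is continuous on `C(ℝ, ℂ)`. [folklore] -/
theorem continuous_rotatePath (θ : ℝ) : Continuous (rotatePath θ) := by
  refine ContinuousMap.continuous_of_continuous_uncurry _ ?_
  change Continuous fun p : C(ℝ, ℂ) × ℝ ↦ exp (θ * I) * p.1 p.2
  fun_prop

/-- Rotation is Borel measurable. [folklore] -/
theorem measurable_rotatePath (θ : ℝ) : Measurable (rotatePath θ) :=
  (continuous_rotatePath θ).measurable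

/-- **Reversal** of a two-sided path: `reversePath γ = γ(-·)` (swaps the two arms, keeps the root).
Zhan (2021), §2.2 (reversibility (i) of two-sided whole-plane SLE_κ). [cite: Zhan2021SLELoopMeasures, §2.2] -/
def reversePath (γ : C(ℝ, ℂ)) : C(ℝ, ℂ) := γ.comp ⟨fun t ↦ -t, continuous_neg⟩

/-- Value of a reversed path. [folklore] -/
@[simp] theorem reversePath_apply (γ : C(ℝ, ℂ)) (t : ℝ) : reversePath γ t = γ (-t) := rfl

/-- Reversal is an involution. [folklore] -/
@[simp] theorem reversePath_reversePath (γ : C(ℝ, ℂ)) : reversePath (reversePath γ) = γ := by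
  ext t; simp

/-- Reversal is continuous on `C(ℝ, ℂ)`. [folklore] -/
theorem continuous_reversePath : Continuous reversePath :=
  ContinuousMap.continuous_precomp _

/-- Reversal is Borel measurable. [folklore] -/
theorem measurable_reversePath : Measurable reversePath :=
  continuous_reversePath.measurable

/-- Reversal preserves the natural parametrisation. [folklore] -/
theorem IsNaturallyParametrized.reversePath {d : ℝ} {γ : C(ℝ, ℂ)}
    (h : IsNaturallyParametrized d γ) : IsNaturallyParametrized d (reversePath γ) :=
  h.comp_neg

/-- The **window `[0, T]` after the root** of a two-sided path, as a naturally parametrised rooted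
curve of duration `T` (`RootedCurve ℂ` of `FusionMap`, the space carrying the route's finite-window
laws): `t ↦ γ(t) - γ(0)` on `[0, T]`, rooted at `0`, frozen outside (`T < 0` is treated as `0`).
`rootedWindow 1` is the **unit natural-length window**. [folklore] -/
def rootedWindow (T : ℝ) (γ : C(ℝ, ℂ)) : RootedCurve ℂ where
  dur := max T 0
  toFun t := γ (max (min t (max T 0)) 0) - γ 0
  dur_nonneg := le_max_right _ _
  continuous_toFun :=
    (γ.continuous.comp ((continuous_id.min continuous_const).max continuous_const)).sub
      continuous_const
  apply_of_nonpos t ht := by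
    rw [max_eq_right ((min_le_left _ _).trans ht), sub_self]
  apply_of_dur_le t ht := by
    rw [min_eq_right ht, min_self]

/-- The duration of the window `[0, T]` is `T ⊔ 0`. [folklore] -/
@[simp] theorem rootedWindow_dur (T : ℝ) (γ : C(ℝ, ℂ)) : (rootedWindow T γ).dur = max T 0 := rfl

/-- Inside `[0, T]` the window is the path seen from its root. [folklore] -/
theorem rootedWindow_apply_of_mem {T t : ℝ} (γ : C(ℝ, ℂ)) (ht : t ∈ Icc 0 T) :
    rootedWindow T γ t = γ t - γ 0 := by
  change γ (max (min t (max T 0)) 0) - γ 0 = _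
  rw [min_eq_left (ht.2.trans (le_max_left _ _)), max_eq_left ht.1]

/-- The shape of a window: `s ↦ γ(s (T ⊔ 0)) - γ(0)`. [folklore] -/
theorem shape_rootedWindow (T : ℝ) (γ : C(ℝ, ℂ)) :
    (rootedWindow T γ).shape =
      γ.comp ⟨fun s : unitInterval ↦ (s : ℝ) * max T 0, continuous_subtype_val.mul continuous_const⟩ -
        ContinuousMap.const unitInterval (γ 0) := by
  ext s
  have hs : (s : ℝ) * max T 0 ∈ Icc 0 (max T 0) :=
    ⟨mul_nonneg s.2.1 (le_max_right _ _), mul_le_of_le_one_left (le_max_right _ _) s.2.2⟩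
  change γ (max (min ((s : ℝ) * max T 0) (max T 0)) 0) - γ 0 = γ ((s : ℝ) * max T 0) - γ 0
  rw [min_eq_left hs.2, max_eq_left hs.1]

/-- Taking the window `[0, T]` is continuous from `C(ℝ, ℂ)` (locally uniform convergence) to
`RootedCurve ℂ` (through the inducing shape coordinates `RootedCurve.isInducing_toShape`).
[folklore] -/
theorem continuous_rootedWindow (T : ℝ) : Continuous (rootedWindow T) := by
  rw [RootedCurve.isInducing_toShape.continuous_iff]
  refine continuous_const.prodMk ?_
  change Continuous fun γ : C(ℝ, ℂ) ↦ (rootedWindow T γ).shape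
  simp_rw [shape_rootedWindow]
  exact (ContinuousMap.continuous_precomp _).sub
    (ContinuousMap.continuous_const'.comp (continuous_eval_const (0 : ℝ)))

/-- Taking the window `[0, T]` is Borel measurable. [folklore] -/
theorem measurable_rootedWindow (T : ℝ) : Measurable (rootedWindow T) :=
  (continuous_rootedWindow T).measurable

/-- The **window class**: the window `[0, T]` of `γ` as an unparametrised curve in `CurveClass ℂ`
(curves modulo reparametrisation, the space of the sub-problem's scaling-limit statements).
[folklore] -/
def windowClass (T : ℝ) (γ : C(ℝ, ℂ)) : CurveClass ℂ :=
  CurveClass.mk ⟨(rootedWindow T γ).shape⟩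

/-- Taking the window class is continuous. [folklore] -/
theorem continuous_windowClass (T : ℝ) : Continuous (windowClass T) := by
  have h1 : Continuous fun γ : C(ℝ, ℂ) ↦ (rootedWindow T γ).shape :=
    continuous_snd.comp (RootedCurve.continuous_toShape.comp (continuous_rootedWindow T))
  exact SeparationQuotient.continuous_mk.comp (Curve.lipschitzWith_mk.continuous.comp h1)

/-- Taking the window class is Borel measurable. [folklore] -/
theorem measurable_windowClass (T : ℝ) : Measurable (windowClass T) :=
  (continuous_windowClass T).measurable

end PathOps


/-! ### Dilations and the scaling covariance of Minkowski content -/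

section Dilation

open scoped Pointwise

/-- Closed neighbourhoods under a real dilation of the plane: `r • N̄_δ(S) = N̄_{|r| δ}(r • S)` for
`r ≠ 0`. [folklore] -/
theorem smul_cthickening_real {r : ℝ} (hr : r ≠ 0) (δ : ℝ) (S : Set ℂ) :
    r • Metric.cthickening δ S = Metric.cthickening (|r| * δ) (r • S) := by
  ext x
  obtain ⟨y, rfl⟩ : ∃ y, x = r • y := ⟨r⁻¹ • x, (smul_inv_smul₀ hr x).symm⟩
  rw [smul_mem_smul_set_iff₀ hr, Metric.mem_cthickening_iff, Metric.mem_cthickening_iff,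
    infEDist_smul₀ hr S y, ENNReal.ofReal_mul (abs_nonneg r), ENNReal.smul_def, smul_eq_mul,
    ← Real.enorm_eq_ofReal_abs, enorm_eq_nnnorm]
  exact (ENNReal.mul_le_mul_iff_right (by simpa using hr) ENNReal.coe_ne_top).symm

/-- Area scales quadratically under real dilations of `ℂ` (Lebesgue measure is an additive Haar
measure on the `2`-dimensional real space `ℂ`). [folklore] -/
theorem volume_smul_real (r : ℝ) (A : Set ℂ) :
    volume (r • A) = ENNReal.ofReal (|r| ^ 2) * volume A := by
  rw [Measure.addHaar_smul, Complex.finrank_real_complex, abs_pow]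

/-- **Scaling covariance of the Minkowski content functional**: for `r, ε > 0`,
`Cont_d(r S; ε) = r^d · Cont_d(S; ε / r)`. Zhan (2021), §2.3 / Lemma 2.6 (conformal covariance of
Minkowski content, here for dilations); Lawler–Rezaei (2015), §2.2. [cite: Zhan2021SLELoopMeasures, §2.3] -/
theorem minkowskiContentAt_smul {d r ε : ℝ} (hr : 0 < r) (hε : 0 < ε) (S : Set ℂ) :
    minkowskiContentAt d ε (r • S) = ENNReal.ofReal (r ^ d) * minkowskiContentAt d (ε / r) S := by
  unfold minkowskiContentAt
  have h1 : Metric.cthickening ε (r • S) = r • Metric.cthickening (ε / r) S := by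
    rw [smul_cthickening_real hr.ne', abs_of_pos hr, mul_div_cancel₀ _ hr.ne']
  rw [h1, volume_smul_real, abs_of_pos hr, ← mul_assoc, ← mul_assoc, ← ENNReal.ofReal_mul (by positivity),
    ← ENNReal.ofReal_mul (by positivity)]
  congr 2
  rw [Real.div_rpow hε.le hr.le, mul_div_assoc', mul_comm (r ^ d), mul_div_assoc, ← Real.rpow_sub hr,
    show d - (d - 2) = ((2 : ℕ) : ℝ) by push_cast; ring, Real.rpow_natCast]

/-- **Minkowski content scales like `r ^ d`** under the dilation `z ↦ r z` (`r > 0`).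
Zhan (2021), §2.3 (scaling covariance of the Minkowski content measure, used in the proof of
Cor. 4.7); Lawler–Sheffield (2011), §1.2 (natural time is multiplied by `r^d`). [cite: Zhan2021SLELoopMeasures, §2.3] -/
theorem HasMinkowskiContent.smul {d r : ℝ} {S : Set ℂ} {m : ℝ≥0∞} (h : HasMinkowskiContent d S m)
    (hr : 0 < r) : HasMinkowskiContent d (r • S) (ENNReal.ofReal (r ^ d) * m) := by
  unfold HasMinkowskiContent at h ⊢
  have hdiv : Tendsto (fun ε : ℝ ↦ ε / r) (𝓝[>] 0) (𝓝[>] 0) := by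
    refine tendsto_nhdsWithin_iff.2 ⟨?_, ?_⟩
    · simpa using ((tendsto_id (x := 𝓝 (0 : ℝ))).div_const r).mono_left nhdsWithin_le_nhds
    · filter_upwards [self_mem_nhdsWithin] with ε hε using div_pos hε hr
  have h' := ENNReal.Tendsto.const_mul (h.comp hdiv) (Or.inr ENNReal.ofReal_ne_top) (a := ENNReal.ofReal (r ^ d))
  refine h'.congr' ?_
  filter_upwards [self_mem_nhdsWithin] with ε hε
  exact (minkowskiContentAt_smul hr hε S).symm

/-- **Dilations with `ν d = 1` preserve the natural parametrisation**: if `γ` is parametrised by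
`d`-dimensional Minkowski content then so is `t ↦ a^ν γ(t / a)` (`a > 0`, `ν = 1/d`): the arc over
`[s, t]` is `a^ν · γ[s/a, t/a]`, of content `(a^ν)^d (t - s)/a = t - s`. This is why self-similarity of
the two-sided SLE is stated with `dilatePath (1/d)` (Zhan (2021), Cor. 4.7: index `1/d`).
[cite: Zhan2021SLELoopMeasures, Cor. 4.7] -/
theorem IsNaturallyParametrized.smul_comp_div {d ν a : ℝ} {γ : ℝ → ℂ} (h : IsNaturallyParametrized d γ)
    (ha : 0 < a) (hνd : ν * d = 1) :
    IsNaturallyParametrized d (fun t ↦ ((a ^ ν : ℝ) : ℂ) * γ (t / a)) := by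
  intro s t hst
  have himage : (fun t ↦ ((a ^ ν : ℝ) : ℂ) * γ (t / a)) '' Icc s t = (a ^ ν) • (γ '' Icc (s / a) (t / a)) := by
    rw [show (fun t ↦ ((a ^ ν : ℝ) : ℂ) * γ (t / a)) = (fun z : ℂ ↦ (a ^ ν : ℝ) • z) ∘ γ ∘ (fun t ↦ t * a⁻¹) by
      ext t; simp [div_eq_mul_inv, Complex.real_smul]]
    rw [image_comp, image_comp, image_mul_right_Icc hst (inv_nonneg.2 ha.le), image_smul]
    simp [div_eq_mul_inv]
  rw [himage]
  have hc := (h (s / a) (t / a) (div_le_div_of_nonneg_right hst ha.le)).smul (Real.rpow_pos_of_pos ha ν)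
  convert hc using 2
  rw [← ENNReal.ofReal_mul (by positivity), ← Real.rpow_mul ha.le, hνd, Real.rpow_one,
    ← sub_div, mul_div_cancel₀ _ ha.ne']


/-- `dilatePath ν a` preserves the natural `d`-parametrisation when `ν d = 1` and `a > 0`.
[cite: Zhan2021SLELoopMeasures, Cor. 4.7] -/
theorem IsNaturallyParametrized.dilatePath {d ν a : ℝ} {γ : C(ℝ, ℂ)} (h : IsNaturallyParametrized d γ)
    (ha : 0 < a) (hνd : ν * d = 1) : IsNaturallyParametrized d (dilatePath ν a γ) :=
  h.smul_comp_div ha hνd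

end Dilation

/-! ### Law-level predicates (hypothesis slots) -/

section LawPredicates

/-- **Rotation invariance** as a predicate on laws of two-sided paths (a hypothesis slot for the
route; for the two-sided whole-plane SLE_κ natural law it follows from the uniqueness of the
stationary driving law, Miller–Sheffield (2013), Prop. 2.1, and the rotation covariance of every
step of the construction, but it is not vendored as a fact here). [folklore] -/
def IsRotationInvariant (μ : Measure C(ℝ, ℂ)) : Prop :=
  ∀ θ : ℝ, μ.map (rotatePath θ) = μ

/-- **Re-rooting stationarity** as a predicate on laws of two-sided rooted paths. [folklore] -/
def IsRerootInvariant (μ : Measure C(ℝ, ℂ)) : Prop :=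
  ∀ s : ℝ, μ.map (reroot s) = μ

/-- **Exact scale invariance (self-similarity of index `ν`)** as a predicate on laws of two-sided
paths: invariance under every dilation `dilatePath ν a`, `a > 0`. [folklore] -/
def IsSelfSimilar (ν : ℝ) (μ : Measure C(ℝ, ℂ)) : Prop :=
  ∀ a : ℝ, 0 < a → μ.map (dilatePath ν a) = μ

end LawPredicates

end Literature.Probability.RandomPlanarGeometry
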